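import Literature.AlgebraicGeometry.Motives.HodgeStructurePicardNumberFiniteDirectSum
import Literature.AlgebraicGeometry.Motives.HodgeStructureHodgeClassesFinrank
import Literature.AlgebraicGeometry.Motives.HodgeStructureExteriorPowerDirectSum
import HarnessLib

/-!
# Hulek–Laface 2019, §3.1 on the carrier: a weight-one polarized Hodge structure splitting into `r` pairwise
# Hom-orthogonal non-zero summands of dimensions `2k₁, …, 2k_r` has Picard number `ρ ≤ k₁² + ⋯ + k_r² ≤ M_{r,g} = (g−(r−1))² + (r−1)`,
# `g = Σ kᵢ`; the numbers `M_{r,g}` decrease strictly from `M_{1,g} = g²` to `M_{g,g} = g`; hence `ρ ≤ (g−1)² + 1` as soon as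
# `r ≥ 2` (Thm. 1.1 (1), case (a)) and `ρ ≤ M_{3,g} < (g−2)² + 4` as soon as `r ≥ 3` (§3.3)

[topic AlgebraicGeometry/Motives]

Layer `Literature/AlgebraicGeometry/Motives`, lane `lit-hodgefound` (Track 2 foundations library; prover seat `lit-hodgefound-p34`,
generation 28, row g28-#2). THEOREMS ONLY (no `def`, no named fact, no instance, no notation; net debt `0`). Sequel of the seat's
g27-#9 `Motives/HodgeStructurePicardNumberFiniteDirectSum` (Hulek–Laface Cor. 2.3 on the carrier: `ρ(⊕_{i ∈ s} Hᵢ) = Σ_{i ∈ s} ρ(Hᵢ)`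
for pairwise Hom-orthogonal polarized factors) and of `Motives/HodgeStructureHodgeClassesFinrank` (`ρ(H) ≤ g²` for an effective weight-one
`H` with `g = h^{1,0}`, Lange §1.3.4 Exercise (10) (b)). The tree has the EXTREMAL half of Prop. 3.1 ("this value is attained", on the
diagonal of the Siegel family: `ModuliOfAbelianVarieties/SiegelFamilyDiagonalPointsEllipticProducts` §7) and the two-factor bound
(`Geometry/Kaehler/ComplexTorusPicardNumberProduct`, `IsIsogenous.finrank_neronSeveriGroup_le_sq_add_sq` / `…_le_sq_pred_add_one`; for
`r` factors of ONE common dimension `ComplexTorusPicardNumberFiniteProduct.finrank_neronSeveriGroup_pi_le_of_pairwise`); here the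
BOUND half for every `r` and arbitrary dimensions `k₁, …, k_r`, with its arithmetic (the maximum of `Σ xᵢ²` on the integral points of
the simplex, Remark 3.3), on the abstract carrier.

## The source, verbatim

K. Hulek, R. Laface, *On the Picard numbers of abelian varieties*, Ann. Sc. Norm. Super. Pisa (2019) [HulekLaface2019PicardNumbersAV]
(held text `paper:arxiv-1703.05882`, chunk p0007), §3.1: "given an abelian variety `A`, Theorem 2.1 gives an isogeny
`A → A₁^{n₁} × ⋯ × A_r^{n_r}`, and we set `r(A) := r`. […] for `r ≤ g`, we define `M_{r,g}` as
`M_{r,g} := max{ρ(A) | dim A = g, r(A) = r}`. **Proposition 3.1.** For integers `r, g ∈ ℕ` such that `r ≤ g`, one has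
`M_{r,g} = [g − (r−1)]² + (r−1)`. This value is attained as the Picard number of `E^{g−r+1} × E₁ × ⋯ × E_{r−1}` […]. *Proof.* If
`A ∼ A₁ × ⋯ × A_r`, `Hom(Aᵢ, Aⱼ) = 0` for `i ≠ j`, then `ρ(A) ≤ k₁² + ⋯ + k_r²` where `kᵢ := dim Aᵢ` (`i = 1, …, r`) and
`k₁ + ⋯ + k_r = g`. Hence we are looking for the maxima of the function `h(x₁, …, x_r) = x₁² + ⋯ + x_r²` on the integral points of the
simplex `Ω_{r,g} = {(x₁, …, x_r) | xᵢ ≥ 1, x₁ + ⋯ + x_r = g}`. These points are precisely the vertices […] the maximum is attained at any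
of these points, with value `h(g−r+1, 1, …, 1) = [g − (r−1)]² + (r−1)`. Therefore, we conclude that `ρ(A) ≤ [g − (r−1)]² + (r−1)`."
**Remark 3.3.** "The numbers `M_{r,g}` give the following (strictly) increasing sequence of positive integers:
`g = M_{g,g} < M_{g−1,g} < ⋯ < M_{3,g} < M_{2,g} < M_{1,g} = g²`."  §3.2 (proof of Thm. 1.1 (1): "Fix `g ≥ 4`. There does not exist any
abelian variety of dimension `g` with Picard number `ρ` in the following range: `(g−1)² + 1 < ρ < g²`"), Case (a): "Since `r(A) ≥ 2`, we
have that `A ∼ A₁ × A₂` with `Hom(A₁, A₂) = 0`. […] `f(x) := x² + (g−x)²` […] attains its maximum at `x = 1` and `x = g−1`, with value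
`f(1) = f(g−1) = (g−1)² + 1`. Therefore, `ρ(A) ≤ (g−1)² + 1`."  §3.3, first display: "if `r(A) ≥ 3`, then
`ρ(A) ≤ M_{r(A),g} ≤ M_{3,g} < (g−2)² + 4`."

## Reading on the carrier, and what is PROVED

`A ∼ A₁ × ⋯ × A_r` with `Hom(Aᵢ, Aⱼ) = 0` becomes: `H = ⊕_{i ∈ s} Hᵢ` (`HodgeStructure.pi` over `↥s`, `|s| = r`), each `Hᵢ` an effective
polarized `ℚ`-Hodge structure of weight `1` on a finite-dimensional `Xᵢ` (`Hᵢ = H¹(Aᵢ, ℚ)`), `Hom_HS(Hᵢ, Hⱼ) = 0` for `i ≠ j`,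
`kᵢ = h^{1,0}(Hᵢ) = dim Aᵢ ≥ 1`, `g = Σ kᵢ = h^{1,0}(H)`; `ρ(H) = dim_ℚ Hdg¹(⋀² H) = finrank ((H.exteriorPower 2).hodgeClasses 1)`.

* §1 THE ARITHMETIC OF `M_{r,g} = (g − (r−1))² + (r−1)` (written out; no definition is introduced): **the simplex lemma**
  `Σ_{i ∈ s} kᵢ² ≤ (Σ kᵢ − (|s|−1))² + (|s|−1)` for `kᵢ ≥ 1`, `s ≠ ∅` (`sum_sq_le_sq_sub_add`; the two-variable step of §3.2 (a),
  `x² + y² ≤ (x+y−1)² + 1`, is the tree's `Geometry/Kaehler/ComplexTorusPicardNumberProduct` `sq_add_sq_le_sq_pred_add_one`, re-derived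
  inline); Remark 3.3: `M_{1,g} = g²`, `M_{g,g} = g`,
  `M_{r+1,g} < M_{r,g}` (`r < g`), `M` is antitone in `r` on `[1, g]`, so `M_{r,g} ≤ (g−1)² + 1` for `2 ≤ r ≤ g` and
  `M_{r,g} ≤ (g−2)² + 2 < (g−2)² + 4` for `3 ≤ r ≤ g`.
* §2 **PROP. 3.1 (THE BOUND) ON THE CARRIER**: `ρ(⊕_{i ∈ s} Hᵢ) ≤ Σ_{i ∈ s} kᵢ²`
  (`Polarization.finrank_hodgeClasses_two_pi_finset_le_sum_sq`: Cor. 2.3 on the carrier and `ρ(Hᵢ) ≤ kᵢ²`);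
  **`ρ(⊕_{i ∈ s} Hᵢ) ≤ (g − (r−1))² + (r−1)`**, `r = |s| ≥ 1`, `g = Σ_{i ∈ s} kᵢ` (`…_le_sq_sub_add`), also with `g` read as
  `h^{1,0}(⊕_{i ∈ s} Hᵢ)` (`…_le_sq_hodgeNumber_sub_add`); THM. 1.1 (1) CASE (a): `r ≥ 2 ⟹ ρ ≤ (g−1)² + 1`
  (`…_le_sq_pred_add_one_of_two_le_card`); §3.3: `r ≥ 3 ⟹ ρ ≤ (g−2)² + 2 < (g−2)² + 4` (`…_of_three_le_card`); and the same for the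
  full sum `⊕ᵢ Hᵢ = HodgeStructure.pi H` over a finite index type (`…_pi_le_sum_sq`, `…_pi_le_sq_sub_add`).

NOT here: the attainment of `M_{r,g}` (the tree's Siegel-family files quoted above), Poincaré's complete reducibility (which would turn
"a splitting of `H`" into "the splitting of `A`"; the statements are for a GIVEN Hom-orthogonal splitting), Thm. 1.1 (1) case (b) and
part (2) (self-products: Murty's Prop. 2.4 / Cor. 2.5 by endomorphism type).

## References

* [HulekLaface2019PicardNumbersAV] K. Hulek, R. Laface, *On the Picard numbers of abelian varieties*, Ann. Sc. Norm. Super. Pisa Cl.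
  Sci. (2019), arXiv:1703.05882 — §3.1 Prop. 3.1, Remark 3.3, §3.2 (a), §3.3, Thm. 1.1 (1); §2.1 Cor. 2.3.
* [Lange2023AbelianVarietiesComplex] H. Lange, *Abelian Varieties over the Complex Numbers* (2023), §1.3.4 Exercise (10) (b) (`ρ ≤ g²`).
* [DeligneHodgeII1971] P. Deligne, *Théorie de Hodge II* (1971), 2.1 (direct sums of Hodge structures).
-/

noncomputable section

namespace Literature.AlgebraicGeometry.Motives.HodgeStructure

universe u

/-! ## §1 The arithmetic of `M_{r,g} = (g − (r−1))² + (r−1)` -/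

section Arithmetic

/-- **THE SIMPLEX LEMMA (Prop. 3.1, proof): for integers `kᵢ ≥ 1` (`i ∈ s`, `s ≠ ∅`), `Σ_{i ∈ s} kᵢ² ≤ (Σ_{i ∈ s} kᵢ − (|s|−1))² + (|s|−1)`**
— "the maxima of `h(x₁, …, x_r) = x₁² + ⋯ + x_r²` on the integral points of the simplex `Ω_{r,g} = {xᵢ ≥ 1, x₁ + ⋯ + x_r = g}` […] are
attained at the vertices, with value `h(g−r+1, 1, …, 1) = [g − (r−1)]² + (r−1)`" (induction on `s`, one variable at a time by the
two-variable inequality `x² + y² ≤ (x + y − 1)² + 1`, `x, y ≥ 1`, of §3.2 (a) — the tree's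
`Geometry.Kaehler.ComplexTorus.sq_add_sq_le_sq_pred_add_one`, re-derived inline to keep this layer below the Kähler layer).
[cite: HulekLaface2019PicardNumbersAV, §3.1 Prop. 3.1 (proof) and §3.2 Case (a)] -/
theorem sum_sq_le_sq_sub_add {ι : Type*} {s : Finset ι} (hs : s.Nonempty) {k : ι → ℕ} (hk : ∀ i ∈ s, 1 ≤ k i) :
    ∑ i ∈ s, k i ^ 2 ≤ (∑ i ∈ s, k i - (s.card - 1)) ^ 2 + (s.card - 1) := by
  induction hs using Finset.Nonempty.cons_induction with
  | singleton a => simp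
  | cons a s ha hs ih =>
    have hka : 1 ≤ k a := hk a (Finset.mem_cons_self a s)
    have hk' : ∀ i ∈ s, 1 ≤ k i := fun i hi ↦ hk i (Finset.mem_cons_of_mem hi)
    have hcard : s.card ≤ ∑ i ∈ s, k i := by
      have h := Finset.card_nsmul_le_sum s k 1 hk'
      rwa [smul_eq_mul, mul_one] at h
    have hpos : 1 ≤ s.card := Finset.card_pos.2 hs
    have step : k a ^ 2 + (∑ i ∈ s, k i - (s.card - 1)) ^ 2 ≤ (k a + (∑ i ∈ s, k i - (s.card - 1)) - 1) ^ 2 + 1 := by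
      -- `x² + y² ≤ (x + y − 1)² + 1` for `x, y ≥ 1`: the difference is `2(x−1)(y−1)`
      obtain ⟨x, hx⟩ := Nat.exists_eq_add_of_le' hka
      obtain ⟨y, hy⟩ := Nat.exists_eq_add_of_le' (Nat.le_sub_of_add_le (by omega : 1 + (s.card - 1) ≤ ∑ i ∈ s, k i))
      rw [hx, hy]
      have exy : x + 1 + (y + 1) - 1 = x + y + 1 := by omega
      rw [exy]
      nlinarith [Nat.zero_le (x * y)]
    rw [Finset.sum_cons, Finset.sum_cons, Finset.card_cons]
    have e : k a + (∑ i ∈ s, k i - (s.card - 1)) - 1 = k a + ∑ i ∈ s, k i - (s.card + 1 - 1) := by omega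
    rw [e] at step
    have ih' := ih hk'
    omega

/-- `r = 1`: **`M_{1,g} = g²`**. [cite: HulekLaface2019PicardNumbersAV, §3.1 Remark 3.3] -/
theorem sq_sub_add_of_one (g : ℕ) : (g - (1 - 1)) ^ 2 + (1 - 1) = g ^ 2 := by
  simp

/-- `r = g ≥ 1`: **`M_{g,g} = g`**. [cite: HulekLaface2019PicardNumbersAV, §3.1 Remark 3.3] -/
theorem sq_sub_add_of_self {g : ℕ} (hg : 1 ≤ g) : (g - (g - 1)) ^ 2 + (g - 1) = g := by
  have e : g - (g - 1) = 1 := by omega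
  rw [e, one_pow]
  omega

/-- **Remark 3.3: `M_{r+1,g} < M_{r,g}` for `1 ≤ r < g`** — "the numbers `M_{r,g}` give the (strictly) increasing sequence
`g = M_{g,g} < M_{g−1,g} < ⋯ < M_{2,g} < M_{1,g} = g²`" (the difference is `2(g − r)`). [cite: HulekLaface2019PicardNumbersAV, §3.1 Remark 3.3] -/
theorem sq_sub_add_lt_sq_sub_add {r g : ℕ} (hr : 1 ≤ r) (hrg : r < g) :
    (g - (r + 1 - 1)) ^ 2 + (r + 1 - 1) < (g - (r - 1)) ^ 2 + (r - 1) := by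
  obtain ⟨r, rfl⟩ := Nat.exists_eq_add_of_le' hr
  obtain ⟨d, rfl⟩ := Nat.exists_eq_add_of_lt hrg
  have e1 : r + 1 + d + 1 - (r + 1 + 1 - 1) = d + 1 := by omega
  have e2 : r + 1 + d + 1 - (r + 1 - 1) = d + 2 := by omega
  have e3 : r + 1 + 1 - 1 = r + 1 := by omega
  have e4 : r + 1 - 1 = r := by omega
  rw [e1, e2, e3, e4]
  nlinarith

/-- **`M_{r,g}` is antitone in `r` on `1 ≤ r ≤ g`: `M_{r',g} ≤ M_{r,g}` for `1 ≤ r ≤ r' ≤ g`.** [cite: HulekLaface2019PicardNumbersAV, §3.1 Remark 3.3] -/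
theorem sq_sub_add_le_sq_sub_add {r r' g : ℕ} (hr : 1 ≤ r) (hrr' : r ≤ r') (hr'g : r' ≤ g) :
    (g - (r' - 1)) ^ 2 + (r' - 1) ≤ (g - (r - 1)) ^ 2 + (r - 1) := by
  induction hrr' with
  | refl => exact le_rfl
  | @step m hrm ih =>
    have hm : (g - (m + 1 - 1)) ^ 2 + (m + 1 - 1) < (g - (m - 1)) ^ 2 + (m - 1) :=
      sq_sub_add_lt_sq_sub_add (hr.trans hrm) (Nat.lt_of_succ_le hr'g)
    exact hm.le.trans (ih (Nat.le_of_succ_le hr'g))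

/-- **`2 ≤ r ≤ g ⟹ M_{r,g} ≤ M_{2,g} = (g−1)² + 1`** (the bound behind Thm. 1.1 (1), case (a)).
[cite: HulekLaface2019PicardNumbersAV, §3.1 Remark 3.3 and §3.2 Case (a)] -/
theorem sq_sub_add_le_sq_sub_one_add_one {r g : ℕ} (hr : 2 ≤ r) (hrg : r ≤ g) :
    (g - (r - 1)) ^ 2 + (r - 1) ≤ (g - 1) ^ 2 + 1 := by
  have h := sq_sub_add_le_sq_sub_add (by norm_num : 1 ≤ 2) hr hrg
  simpa using h

/-- **`3 ≤ r ≤ g ⟹ M_{r,g} ≤ M_{3,g} = (g−2)² + 2 < (g−2)² + 4`** — "if `r(A) ≥ 3`, then `ρ(A) ≤ M_{r(A),g} ≤ M_{3,g} < (g−2)² + 4`".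
[cite: HulekLaface2019PicardNumbersAV, §3.3 (first display) and Remark 3.3] -/
theorem sq_sub_add_le_sq_sub_two_add_two {r g : ℕ} (hr : 3 ≤ r) (hrg : r ≤ g) :
    (g - (r - 1)) ^ 2 + (r - 1) ≤ (g - 2) ^ 2 + 2 ∧ (g - 2) ^ 2 + 2 < (g - 2) ^ 2 + 4 := by
  have h := sq_sub_add_le_sq_sub_add (by norm_num : 1 ≤ 3) hr hrg
  exact ⟨by simpa using h, by omega⟩

end Arithmetic

/-! ## §2 Prop. 3.1 (the bound) on the carrier -/

section Carrier

variable {ι : Type} [Fintype ι] [DecidableEq ι] {X : ι → Type u} [∀ i, AddCommGroup (X i)] [∀ i, Module ℚ (X i)]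
  [∀ i, Module.Finite ℚ (X i)] (H : ∀ i, HodgeStructure (X i) 1) [HodgeTensorFacts.{u, u}] (Q : ∀ i, Polarization (H i))
  (hE : ∀ i, (H i).IsEffective)

include Q hE in
/-- **PROP. 3.1 (proof), first display, on the carrier: "`A ∼ A₁ × ⋯ × A_r`, `Hom(Aᵢ, Aⱼ) = 0` for `i ≠ j` ⟹ `ρ(A) ≤ k₁² + ⋯ + k_r²`",
`kᵢ = dim Aᵢ`** — `ρ(⊕_{i ∈ s} Hᵢ) = Σ_{i ∈ s} ρ(Hᵢ)` (Cor. 2.3, g27-#9) and `ρ(Hᵢ) ≤ kᵢ²` with `kᵢ = h^{1,0}(Hᵢ)`.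
[cite: HulekLaface2019PicardNumbersAV, §3.1 Prop. 3.1 (proof) and §2.1 Cor. 2.3] [cite: Lange2023AbelianVarietiesComplex, §1.3.4 Exercise (10) (b)] -/
theorem Polarization.finrank_hodgeClasses_two_pi_finset_le_sum_sq (hHom : ∀ i j, i ≠ j → Subsingleton (Hom (H i) (H j)))
    (s : Finset ι) :
    Module.finrank ℚ ↥(((HodgeStructure.pi fun j : ↥s ↦ H j.1).exteriorPower 2).hodgeClasses 1) ≤
      ∑ i ∈ s, (H i).hodgeNumber 1 0 ^ 2 := by
  rw [Polarization.finrank_hodgeClasses_two_pi_finset_eq_sum_of_subsingleton_hom H Q hHom s]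
  exact Finset.sum_le_sum fun i _ ↦ finrank_hodgeClasses_exteriorPower_two_le (H i) (hE i)

include Q hE in
/-- **PROP. 3.1 ON THE CARRIER: `ρ(⊕_{i ∈ s} Hᵢ) ≤ M_{r,g} = (g − (r−1))² + (r−1)`** for `r = |s| ≥ 1` pairwise Hom-orthogonal
effective polarized weight-one summands with `kᵢ = h^{1,0}(Hᵢ) ≥ 1` and `g = Σ_{i ∈ s} kᵢ` — "Therefore, we conclude that
`ρ(A) ≤ [g − (r−1)]² + (r−1)`" (the first display and the simplex lemma). [cite: HulekLaface2019PicardNumbersAV, §3.1 Prop. 3.1] -/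
theorem Polarization.finrank_hodgeClasses_two_pi_finset_le_sq_sub_add (hHom : ∀ i j, i ≠ j → Subsingleton (Hom (H i) (H j)))
    {s : Finset ι} (hs : s.Nonempty) (hk : ∀ i ∈ s, 1 ≤ (H i).hodgeNumber 1 0) :
    Module.finrank ℚ ↥(((HodgeStructure.pi fun j : ↥s ↦ H j.1).exteriorPower 2).hodgeClasses 1) ≤
      (∑ i ∈ s, (H i).hodgeNumber 1 0 - (s.card - 1)) ^ 2 + (s.card - 1) :=
  (Polarization.finrank_hodgeClasses_two_pi_finset_le_sum_sq H Q hE hHom s).trans (sum_sq_le_sq_sub_add hs hk)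

omit [Fintype ι] [HodgeTensorFacts.{u, u}] in
/-- `g = h^{1,0}(⊕_{i ∈ s} Hᵢ) = Σ_{i ∈ s} kᵢ` (the Hodge numbers of a direct sum add up). [cite: DeligneHodgeII1971, 2.1]
[cite: HulekLaface2019PicardNumbersAV, §3.1 Prop. 3.1 (proof: "`k₁ + ⋯ + k_r = g`")] -/
theorem hodgeNumber_pi_finset_eq_sum (s : Finset ι) (p q : ℤ) :
    (HodgeStructure.pi fun j : ↥s ↦ H j.1).hodgeNumber p q = ∑ i ∈ s, (H i).hodgeNumber p q := by
  rw [hodgeNumber_pi]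
  exact Finset.sum_coe_sort s (fun i ↦ (H i).hodgeNumber p q)

include Q hE in
/-- **Prop. 3.1 on the carrier with `g` read as `h^{1,0}` of the sum: `ρ(H) ≤ (h^{1,0}(H) − (r−1))² + (r−1)` for `H = ⊕_{i ∈ s} Hᵢ`
split into `r = |s| ≥ 1` pairwise Hom-orthogonal non-zero effective polarized weight-one summands.**
[cite: HulekLaface2019PicardNumbersAV, §3.1 Prop. 3.1] -/
theorem Polarization.finrank_hodgeClasses_two_pi_finset_le_sq_hodgeNumber_sub_add
    (hHom : ∀ i j, i ≠ j → Subsingleton (Hom (H i) (H j))) {s : Finset ι} (hs : s.Nonempty)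
    (hk : ∀ i ∈ s, 1 ≤ (H i).hodgeNumber 1 0) :
    Module.finrank ℚ ↥(((HodgeStructure.pi fun j : ↥s ↦ H j.1).exteriorPower 2).hodgeClasses 1) ≤
      ((HodgeStructure.pi fun j : ↥s ↦ H j.1).hodgeNumber 1 0 - (s.card - 1)) ^ 2 + (s.card - 1) := by
  rw [hodgeNumber_pi_finset_eq_sum H s 1 0]
  exact Polarization.finrank_hodgeClasses_two_pi_finset_le_sq_sub_add H Q hE hHom hs hk

include Q hE in
/-- **THM. 1.1 (1), CASE (a), ON THE CARRIER: at least two pairwise Hom-orthogonal non-zero summands (`r(A) ≥ 2`) ⟹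
`ρ ≤ (g−1)² + 1`** (`g = Σ kᵢ`) — "Therefore, `ρ(A) ≤ (g−1)² + 1`": no Picard number strictly between `(g−1)² + 1` and `g²` for such
`H`. [cite: HulekLaface2019PicardNumbersAV, §3.2 Case (a) and Thm. 1.1 (1)] -/
theorem Polarization.finrank_hodgeClasses_two_pi_finset_le_sq_sub_one_add_one_of_two_le_card
    (hHom : ∀ i j, i ≠ j → Subsingleton (Hom (H i) (H j))) {s : Finset ι} (hs : 2 ≤ s.card)
    (hk : ∀ i ∈ s, 1 ≤ (H i).hodgeNumber 1 0) :
    Module.finrank ℚ ↥(((HodgeStructure.pi fun j : ↥s ↦ H j.1).exteriorPower 2).hodgeClasses 1) ≤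
      (∑ i ∈ s, (H i).hodgeNumber 1 0 - 1) ^ 2 + 1 := by
  have hne : s.Nonempty := Finset.card_pos.1 (by omega)
  have hcard : s.card ≤ ∑ i ∈ s, (H i).hodgeNumber 1 0 := by
    have h := Finset.card_nsmul_le_sum s (fun i ↦ (H i).hodgeNumber 1 0) 1 hk
    rwa [smul_eq_mul, mul_one] at h
  exact (Polarization.finrank_hodgeClasses_two_pi_finset_le_sq_sub_add H Q hE hHom hne hk).trans
    (sq_sub_add_le_sq_sub_one_add_one hs hcard)

include Q hE in
/-- **§3.3 ON THE CARRIER: at least three pairwise Hom-orthogonal non-zero summands (`r(A) ≥ 3`) ⟹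
`ρ ≤ M_{3,g} = (g−2)² + 2 < (g−2)² + 4`** (`g = Σ kᵢ`). [cite: HulekLaface2019PicardNumbersAV, §3.3 (first display)] -/
theorem Polarization.finrank_hodgeClasses_two_pi_finset_le_sq_sub_two_add_two_of_three_le_card
    (hHom : ∀ i j, i ≠ j → Subsingleton (Hom (H i) (H j))) {s : Finset ι} (hs : 3 ≤ s.card)
    (hk : ∀ i ∈ s, 1 ≤ (H i).hodgeNumber 1 0) :
    Module.finrank ℚ ↥(((HodgeStructure.pi fun j : ↥s ↦ H j.1).exteriorPower 2).hodgeClasses 1) ≤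
        (∑ i ∈ s, (H i).hodgeNumber 1 0 - 2) ^ 2 + 2 ∧
      Module.finrank ℚ ↥(((HodgeStructure.pi fun j : ↥s ↦ H j.1).exteriorPower 2).hodgeClasses 1) <
        (∑ i ∈ s, (H i).hodgeNumber 1 0 - 2) ^ 2 + 4 := by
  have hne : s.Nonempty := Finset.card_pos.1 (by omega)
  have hcard : s.card ≤ ∑ i ∈ s, (H i).hodgeNumber 1 0 := by
    have h := Finset.card_nsmul_le_sum s (fun i ↦ (H i).hodgeNumber 1 0) 1 hk
    rwa [smul_eq_mul, mul_one] at h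
  have h := (Polarization.finrank_hodgeClasses_two_pi_finset_le_sq_sub_add H Q hE hHom hne hk).trans
    (sq_sub_add_le_sq_sub_two_add_two hs hcard).1
  exact ⟨h, by omega⟩

include Q hE in
/-- **The full sum: `ρ(⊕ᵢ Hᵢ) ≤ Σᵢ kᵢ²`** for a finite pairwise Hom-orthogonal family of effective polarized weight-one Hodge structures
(`⊕ᵢ Hᵢ = HodgeStructure.pi H`). [cite: HulekLaface2019PicardNumbersAV, §3.1 Prop. 3.1 (proof)] [cite: Lange2023AbelianVarietiesComplex, §1.3.4 Exercise (10) (b)] -/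
theorem Polarization.finrank_hodgeClasses_two_pi_le_sum_sq (hHom : ∀ i j, i ≠ j → Subsingleton (Hom (H i) (H j))) :
    Module.finrank ℚ ↥(((HodgeStructure.pi H).exteriorPower 2).hodgeClasses 1) ≤ ∑ i, (H i).hodgeNumber 1 0 ^ 2 := by
  rw [Polarization.finrank_hodgeClasses_two_pi_eq_sum_of_subsingleton_hom H Q hHom]
  exact Finset.sum_le_sum fun i _ ↦ finrank_hodgeClasses_exteriorPower_two_le (H i) (hE i)

include Q hE in
/-- **The full sum: `ρ(⊕ᵢ Hᵢ) ≤ (g − (r−1))² + (r−1)`, `r = |ι| ≥ 1`, `g = Σᵢ kᵢ = h^{1,0}(⊕ᵢ Hᵢ)`, `kᵢ ≥ 1`.**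
[cite: HulekLaface2019PicardNumbersAV, §3.1 Prop. 3.1] -/
theorem Polarization.finrank_hodgeClasses_two_pi_le_sq_sub_add [Nonempty ι] (hHom : ∀ i j, i ≠ j → Subsingleton (Hom (H i) (H j)))
    (hk : ∀ i, 1 ≤ (H i).hodgeNumber 1 0) :
    Module.finrank ℚ ↥(((HodgeStructure.pi H).exteriorPower 2).hodgeClasses 1) ≤
      ((HodgeStructure.pi H).hodgeNumber 1 0 - (Fintype.card ι - 1)) ^ 2 + (Fintype.card ι - 1) := by
  rw [hodgeNumber_pi, ← Finset.card_univ]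
  exact (Polarization.finrank_hodgeClasses_two_pi_le_sum_sq H Q hE hHom).trans
    (sum_sq_le_sq_sub_add Finset.univ_nonempty fun i _ ↦ hk i)

end Carrier

end Literature.AlgebraicGeometry.Motives.HodgeStructure

end
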